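import Summits.Ventures.YMGap.Thresholds.StarLimitTorus
import Summits.Ventures.YMGap.Thresholds.StarFrontLemmaG
import Literature.MathematicalPhysics.QuantumFieldTheory.LatticeGaugeShenZhuZhuProofs
import Literature.Barriers.QuantumFields.DiscreteSubgroupFreezing
import HarnessLib

/-!
# Venture YMGap — track (c) «DS»: every infinite-volume limit state of `SU(2)` lattice Yang–Mills
# (`d = 4`, Wilson) is MASSIVE wherever the star window bound holds — the infinite-volume mixing
# clause of the star door, kernel-checked given `StarWindowBound`

HONEST FRAMING: venture file (cell `pub-ymgap`, PLAN R99/R101/R102), strong-coupling LATTICE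
statement only.  INPUT: the hypothesis schema `StarWindowBound L β_W ρ r` of `StarWindow.lean` on all
large tori with ONE received sum `ρ < 1` (the cell's Lemma G delivers it for `β_W ≤ 1/2` with
`ρ = R_G(β_W) = 6c(1+c)/(1−4c−6c²)`, `c = β_W/4`, `R_G < 1` iff `β_W < (√37−5)/3 = 0.3609…`; its Lean
assembly `starWindowBound_lemmaG` is ds-4's `StarLemmaG` chain, NOT this file).  OUTPUT, kernel-checked
GIVEN that input: for every infinite-volume limit state `μ` of the torus Wilson states at tree coupling
`β_W/2` (`μ ∈ infiniteVolumeLimitPoints (d := 4) (fundamentalRep (Fin 2)) (β_W/2)`, subsequential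
limits `L_k + 1 → ∞`) and every pair of bounded measurable local observables `F₁, F₂` of `ℤ⁴`,
`|cov_μ(F₁, F₂ ∘ θ_x)| ≤ C(F₁, F₂) e^{−κ(ρ) ‖x‖_∞}`, `κ(ρ) = (1 − ρ)²/(2(16ρ + 1))` — i.e. `μ` is a
MASSIVE STATE in the sense of the barrier catalogue (`Literature.Barriers.QuantumFields.IsMassiveState`,
the clustering clause (iii) of the tree's `osterwalder_seiler_strongCoupling`).  What this file does
NOT say: uniqueness of the infinite-volume DLR state (class A, App. S of the cell's paper — it needs
the star window bound for the `ℤ⁴` kernels, which no tree file proves), anything at a coupling where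
the hypothesis is not supplied, anything about the continuum, confinement or a transfer-matrix gap.

Method (all inputs are tree theorems).  A limit state is a DLR state of the `ℤ⁴` specification
(`mem_ymGibbsMeasures_of_mem_infiniteVolumeLimitPoints_holds`), so `F₁` and `F₂ ∘ θ_x` may be replaced
by their DLR smoothings `γ_Λ F` over their own supports (`integral_specAvg`, `integral_specAvg_mul`:
the three integrals of the covariance are unchanged once the supports are `‖x‖_∞ ≥ D + 6` apart).  The
smoothed observables are bounded CONTINUOUS cylinder observables (Feller property for measurable `F`
living inside `Λ`, `StarLimitTorus.continuous_specAvg_ymSpecification`), so the weak-limit step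
`StarLimit.su2Star_limit_far_bound` (torus star door along the subsequence) applies; near/far split as
in `StarFront`.

Contents: `su2Star_limitState_cov_far`, `su2Star_limitState_covariance_decay` (ONE constant for
all limit states and displacements), `su2Star_isMassiveState`, `su2_isMassiveState_of_lemmaG` (the
`hG` of `DSWindow.su2_strongCouplingFront_of_lemmaG`), `su2_isMassiveState_le_9_25_of_lemmaG`.
References: cell files `GAUGE-STAR.md` (ds-2), `LEAN-KROW.md` (ds-1), `UNIQUENESS-K-SCOPE.md` (ds-3);
Föllmer, LNM 1362 (1988) Ch. I Thm. (2.13); Dobrushin–Shlosman (1985); Osterwalder–Seiler, Ann.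
Phys. 110 (1978) §4; Georgii (2011) Thm. 4.17.
-/

noncomputable section

open MeasureTheory ProbabilityTheory Function Finset Filter Topology
open Literature.Probability.LatticeModels
open Literature.Probability.LatticeModels.DobrushinMetric
open Literature.MathematicalPhysics.QuantumLattice (toTorusObservable toTorusObservable_apply IsCylinder
  LGConfig torusLift torusEdge fundamentalRep fundamentalLatticeRep
  configShift_apply infiniteVolumeLimitPoints IsInfiniteVolumeLimitAlong ymSpecification ymGibbsMeasures plaquettesTouching
  plaquetteEdges mem_plaquettesTouching_iff wilsonBoundaryAction continuous_fundamentalRep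
  integral_ymSpecification continuous_integral_glueWith normaliser_pos exists_bound_of_continuous
  continuous_glueWith_prod dependsOn_integral_ymSpecification continuous_wilsonBoundaryAction
  mem_ymGibbsMeasures_of_mem_infiniteVolumeLimitPoints_holds
  exists_near_of_mem_plaquettesTouching_biUnion IsZdGaugeInvariant)
open Literature.MathematicalPhysics.QuantumFieldTheory
open Literature.MathematicalPhysics.QuantumFieldTheory.Balaban1983to89
open Literature.MathematicalPhysics.QuantumFieldTheory.Balaban1983to89.StrongCouplingTorusWindow
open Literature.Barriers.QuantumFields (IsMassiveState)
open Summit.Ventures.YMGap.DSWindow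
open Summit.Ventures.YMGap.StarWindowGauge (gaugeR)

namespace Summit.Ventures.YMGap.StarLimit

/-- **Far-regime covariance bound for a limit state, bounded MEASURABLE local observables**
(`SU(2)`, `d = 4`): DLR smoothing under the limit state (a DLR state of the `ℤ⁴` specification)
followed by the weak-limit step `su2Star_limit_far_bound` for the (continuous) smoothed observables.
Here `D` bounds `‖a₀ − b₀‖_∞` over the supports `S₁ × S₂` and `‖x‖_∞ ≥ D + 6`. -/
theorem su2Star_limitState_cov_far (βW : ℝ) {ρ : ℝ} (hρ0 : 0 ≤ ρ) (hρ1 : ρ < 1) (L₁ : ℕ)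
    (hS : ∀ (L : ℕ) [NeZero L], L₁ ≤ L → StarWindowBound L βW ρ suFrobDist)
    {μ : Measure (LGConfig 4 (Matrix.specialUnitaryGroup (Fin 2) ℂ))} {Lseq : ℕ → ℕ}
    (hLmono : StrictMono Lseq)
    (hμL : IsInfiniteVolumeLimitAlong (d := 4) (fundamentalRep (Fin 2)) (βW / 2) Lseq μ)
    {F₁ F₂ : LGConfig 4 (Matrix.specialUnitaryGroup (Fin 2) ℂ) → ℝ} (h₁m : Measurable F₁)
    (h₂m : Measurable F₂) {S₁ S₂ : Finset (Literature.MathematicalPhysics.QuantumLattice.ZdEdge 4)}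
    (hS₁ : IsCylinder F₁ S₁) (hS₂ : IsCylinder F₂ S₂) {M₁ M₂ : ℝ} (hM₁ : ∀ U, |F₁ U| ≤ M₁)
    (hM₂ : ∀ U, |F₂ U| ≤ M₂) (x : Literature.Probability.LatticeModels.Site 4) {D : ℕ}
    (hD : ∀ a₀ ∈ S₁, ∀ b₀ ∈ S₂,
      Literature.Probability.LatticeModels.Site.supNorm (a₀.1 - b₀.1) ≤ D)
    (hfar : D + 6 ≤ Literature.Probability.LatticeModels.Site.supNorm x) :
    |(∫ U, F₁ U * (F₂ ∘ Literature.MathematicalPhysics.QuantumLattice.configShift x) U ∂μ) -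
        (∫ U, F₁ U ∂μ) *
          ∫ U, (F₂ ∘ Literature.MathematicalPhysics.QuantumLattice.configShift x) U ∂μ| ≤
      4 * (2 * Real.sqrt 2) ^ 2 *
        Real.exp (-(starRate ρ *
          ((Literature.Probability.LatticeModels.Site.supNorm x - (D + 2 + 4) : ℕ) : ℝ))) *
        (((((1 + 4 * (2 * (4 - 1))) * S₁.card : ℕ) : ℝ)) * (((1 + 4 * (2 * (4 - 1)) : ℕ) : ℝ)) *
          (M₁ * wilsonSmoothLip 2 4 (βW / 2))) *
        (((((1 + 4 * (2 * (4 - 1))) * S₂.card : ℕ) : ℝ)) * (((1 + 4 * (2 * (4 - 1)) : ℕ) : ℝ)) *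
          (M₂ * wilsonSmoothLip 2 4 (βW / 2))) := by
  classical
  haveI : SecondCountableTopology (Matrix (Fin 2) (Fin 2) ℂ) :=
    inferInstanceAs (SecondCountableTopology (Fin 2 → Fin 2 → ℂ))
  haveI : SecondCountableTopology (Matrix.specialUnitaryGroup (Fin 2) ℂ) :=
    Topology.IsEmbedding.subtypeVal.secondCountableTopology
  haveI := hμL.1
  have hM₁0 : 0 ≤ M₁ := (abs_nonneg _).trans (hM₁ fun _ => 1)
  have hM₂0 : 0 ≤ M₂ := (abs_nonneg _).trans (hM₂ fun _ => 1)
  have hE0 : 0 ≤ wilsonSmoothLip 2 4 (βW / 2) := wilsonSmoothLip_nonneg (by norm_num) 4 (βW / 2)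
  have hJ0 : (0 : ℝ) ≤ (((1 + 4 * (2 * (4 - 1)) : ℕ) : ℝ)) := Nat.cast_nonneg _
  have hρc := continuous_fundamentalRep (Fin 2)
  set γ := ymSpecification (d := 4) (fundamentalRep (Fin 2)) (βW / 2) with hγdef
  have hγ : IsSpecification γ := isSpecification_ymSpecification_of_t2Space _ hρc _
  have hGibbs : IsGibbsMeasure γ μ :=
    mem_ymGibbsMeasures_of_mem_infiniteVolumeLimitPoints_holds (d := 4) (fundamentalRep (Fin 2))
      hρc ⟨Lseq, hLmono, hμL⟩
  set Gx : LGConfig 4 (Matrix.specialUnitaryGroup (Fin 2) ℂ) → ℝ :=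
    F₂ ∘ Literature.MathematicalPhysics.QuantumLattice.configShift x with hGxdef
  obtain ⟨S₂x, hS₂x⟩ : ∃ S : Finset (Literature.MathematicalPhysics.QuantumLattice.ZdEdge 4),
      S = S₂.image fun e => (e.1 - x, e.2) := ⟨_, rfl⟩
  have hGxS : IsCylinder Gx S₂x := by
    rw [hS₂x]; exact IsCylinder.comp_configShift hS₂ x
  have hGxm : Measurable Gx :=
    h₂m.comp (Literature.MathematicalPhysics.QuantumLattice.configShift x).measurable
  have hGxM : ∀ U, |Gx U| ≤ M₂ := fun U => hM₂ _
  -- the smoothed observables: measurable, bounded, cylinders on support ∪ collar, CONTINUOUS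
  set f₁ : LGConfig 4 (Matrix.specialUnitaryGroup (Fin 2) ℂ) → ℝ := specAvg γ S₁ F₁ with hf₁def
  set g₂ : LGConfig 4 (Matrix.specialUnitaryGroup (Fin 2) ℂ) → ℝ := specAvg γ S₂x Gx with hg₂def
  have hf₁m : Measurable f₁ := measurable_specAvg hγ S₁ h₁m
  have hg₂m : Measurable g₂ := measurable_specAvg hγ S₂x hGxm
  have hf₁M : ∀ U, |f₁ U| ≤ M₁ := abs_specAvg_le hγ S₁ hM₁
  have hg₂M : ∀ U, |g₂ U| ≤ M₂ := abs_specAvg_le hγ S₂x hGxM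
  obtain ⟨T₁, hT₁⟩ : ∃ T : Finset (Literature.MathematicalPhysics.QuantumLattice.ZdEdge 4),
      T = S₁ ∪ (plaquettesTouching S₁).biUnion plaquetteEdges := ⟨_, rfl⟩
  obtain ⟨T₂, hT₂⟩ : ∃ T : Finset (Literature.MathematicalPhysics.QuantumLattice.ZdEdge 4),
      T = S₂x ∪ (plaquettesTouching S₂x).biUnion plaquetteEdges := ⟨_, rfl⟩
  have hf₁T : IsCylinder f₁ T₁ := by
    rw [hT₁]
    exact dependsOn_integral_ymSpecification (fundamentalRep (Fin 2)) hρc (βW / 2) S₁ h₁m hS₁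
  have hg₂T : IsCylinder g₂ T₂ := by
    rw [hT₂]
    exact dependsOn_integral_ymSpecification (fundamentalRep (Fin 2)) hρc (βW / 2) S₂x hGxm hGxS
  have hf₁c : Continuous f₁ :=
    continuous_specAvg_ymSpecification (fundamentalRep (Fin 2)) hρc (βW / 2) S₁ h₁m hS₁ hM₁
  have hg₂c : Continuous g₂ :=
    continuous_specAvg_ymSpecification (fundamentalRep (Fin 2)) hρc (βW / 2) S₂x hGxm hGxS hGxM
  -- geometry: base points of `T₁` and `T₂ + x` are within `D + 2`; hence `T₁ ∩ T₂ = ∅`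
  have hxD : ∀ a ∈ T₁, ∀ b ∈ T₂,
      Literature.Probability.LatticeModels.Site.supNorm (a.1 - (b.1 + x)) ≤ D + 2 := by
    intro a ha b hb
    rw [hT₁] at ha
    rw [hT₂, hS₂x] at hb
    exact supNorm_le_of_mem_union_collar hD x ha hb
  have hdisj : ∀ a ∈ T₁, ∀ b ∈ T₂, a ≠ b := by
    intro a ha b hb hab
    subst hab
    have h := hxD a ha a hb
    have hax : a.1 - (a.1 + x) = -x := sub_add_cancel_left a.1 x
    have hneg : Literature.Probability.LatticeModels.Site.supNorm (-x) =
        Literature.Probability.LatticeModels.Site.supNorm x := by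
      simp only [Literature.Probability.LatticeModels.Site.supNorm, Pi.neg_apply, Int.natAbs_neg]
    rw [hax, hneg] at h
    omega
  -- DLR smoothing: the three integrals are unchanged
  have hI₁ : ∫ U, F₁ U * Gx U ∂μ = ∫ U, f₁ U * g₂ U ∂μ := by
    have hS₁T₁ : ∀ e ∈ S₁, e ∈ T₁ := fun e he => by rw [hT₁]; exact Finset.mem_union_left _ he
    have hS₂T₂ : ∀ e ∈ S₂x, e ∈ T₂ := fun e he => by rw [hT₂]; exact Finset.mem_union_left _ he
    have ha : ∫ U, f₁ U * Gx U ∂μ = ∫ U, F₁ U * Gx U ∂μ :=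
      integral_specAvg_mul hγ hGibbs S₁ h₁m hM₁ hGxm hGxM hGxS fun e he heS =>
        hdisj e (hS₁T₁ e he) e (hS₂T₂ e (Finset.mem_coe.1 heS)) rfl
    have hb : ∫ U, g₂ U * f₁ U ∂μ = ∫ U, Gx U * f₁ U ∂μ :=
      integral_specAvg_mul hγ hGibbs S₂x hGxm hGxM hf₁m hf₁M hf₁T fun e he heT =>
        hdisj e (Finset.mem_coe.1 heT) e (hS₂T₂ e he) rfl
    calc ∫ U, F₁ U * Gx U ∂μ = ∫ U, f₁ U * Gx U ∂μ := ha.symm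
      _ = ∫ U, Gx U * f₁ U ∂μ := integral_congr_ae (ae_of_all _ fun U => mul_comm _ _)
      _ = ∫ U, g₂ U * f₁ U ∂μ := hb.symm
      _ = ∫ U, f₁ U * g₂ U ∂μ := integral_congr_ae (ae_of_all _ fun U => mul_comm _ _)
  have hI₂ : ∫ U, F₁ U ∂μ = ∫ U, f₁ U ∂μ := (integral_specAvg hγ hGibbs S₁ h₁m hM₁).symm
  have hI₃ : ∫ U, Gx U ∂μ = ∫ U, g₂ U ∂μ := (integral_specAvg hγ hGibbs S₂x hGxm hGxM).symm
  rw [hI₁, hI₂, hI₃]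
  have hfar' : D + 2 + 4 ≤ Literature.Probability.LatticeModels.Site.supNorm x := by omega
  have hle := su2Star_limit_far_bound βW hρ0 hρ1 L₁ hS hLmono hμL hf₁c hg₂c hf₁m hg₂m hf₁T hg₂T
    hf₁M hg₂M x hxD hfar'
  refine hle.trans ?_
  have hcard₁ : (T₁.card : ℝ) ≤ ((((1 + 4 * (2 * (4 - 1))) * S₁.card : ℕ) : ℝ)) := by
    have h1 : T₁.card ≤ (1 + 4 * (2 * (4 - 1))) * S₁.card := by
      rw [hT₁]; exact card_union_collar_le S₁
    exact_mod_cast h1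
  have hcard₂ : (T₂.card : ℝ) ≤ ((((1 + 4 * (2 * (4 - 1))) * S₂.card : ℕ) : ℝ)) := by
    have h1 : T₂.card ≤ (1 + 4 * (2 * (4 - 1))) * S₂x.card := by
      rw [hT₂]; exact card_union_collar_le S₂x
    have h2 : S₂x.card ≤ S₂.card := by rw [hS₂x]; exact Finset.card_image_le
    exact_mod_cast h1.trans (Nat.mul_le_mul_left _ h2)
  have hME₁ : 0 ≤ M₁ * wilsonSmoothLip 2 4 (βW / 2) := mul_nonneg hM₁0 hE0
  have hME₂ : 0 ≤ M₂ * wilsonSmoothLip 2 4 (βW / 2) := mul_nonneg hM₂0 hE0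
  have hA₁ : (T₁.card : ℝ) * (((1 + 4 * (2 * (4 - 1)) : ℕ) : ℝ)) * (M₁ * wilsonSmoothLip 2 4 (βW / 2)) ≤
      ((((1 + 4 * (2 * (4 - 1))) * S₁.card : ℕ) : ℝ)) * (((1 + 4 * (2 * (4 - 1)) : ℕ) : ℝ)) *
        (M₁ * wilsonSmoothLip 2 4 (βW / 2)) :=
    mul_le_mul_of_nonneg_right (mul_le_mul_of_nonneg_right hcard₁ hJ0) hME₁
  have hA₂ : (T₂.card : ℝ) * (((1 + 4 * (2 * (4 - 1)) : ℕ) : ℝ)) * (M₂ * wilsonSmoothLip 2 4 (βW / 2)) ≤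
      ((((1 + 4 * (2 * (4 - 1))) * S₂.card : ℕ) : ℝ)) * (((1 + 4 * (2 * (4 - 1)) : ℕ) : ℝ)) *
        (M₂ * wilsonSmoothLip 2 4 (βW / 2)) :=
    mul_le_mul_of_nonneg_right (mul_le_mul_of_nonneg_right hcard₂ hJ0) hME₂
  have hA₁0 : 0 ≤ (T₁.card : ℝ) * (((1 + 4 * (2 * (4 - 1)) : ℕ) : ℝ)) *
      (M₁ * wilsonSmoothLip 2 4 (βW / 2)) :=
    mul_nonneg (mul_nonneg (Nat.cast_nonneg _) hJ0) hME₁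
  have hA₂0 : 0 ≤ (T₂.card : ℝ) * (((1 + 4 * (2 * (4 - 1)) : ℕ) : ℝ)) *
      (M₂ * wilsonSmoothLip 2 4 (βW / 2)) :=
    mul_nonneg (mul_nonneg (Nat.cast_nonneg _) hJ0) hME₂
  have hB₁0 : 0 ≤ ((((1 + 4 * (2 * (4 - 1))) * S₁.card : ℕ) : ℝ)) *
      (((1 + 4 * (2 * (4 - 1)) : ℕ) : ℝ)) * (M₁ * wilsonSmoothLip 2 4 (βW / 2)) :=
    mul_nonneg (mul_nonneg (Nat.cast_nonneg _) hJ0) hME₁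
  have hP0 : 0 ≤ 4 * (2 * Real.sqrt 2) ^ 2 * Real.exp (-(starRate ρ *
      ((Literature.Probability.LatticeModels.Site.supNorm x - (D + 2 + 4) : ℕ) : ℝ))) := by
    positivity
  exact mul_le_mul (mul_le_mul_of_nonneg_left hA₁ hP0) hA₂ hA₂0 (mul_nonneg hP0 hB₁0)

/-- **Exponential clustering of every infinite-volume limit state from the star window bound**
(`SU(2)`, `d = 4`, Wilson coupling `β_W`): if every torus of side `L ≥ L₁` carries
`StarWindowBound L β_W ρ suFrobDist` with ONE received sum `ρ < 1`, then for all bounded measurable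
local observables `F₁, F₂` of `ℤ⁴` there is ONE constant `C` such that for EVERY infinite-volume limit
state `μ ∈ infiniteVolumeLimitPoints (d := 4) (fundamentalRep (Fin 2)) (β_W/2)` of the torus Wilson
states and every displacement `x ∈ ℤ⁴`,
`|cov_μ(F₁, F₂ ∘ θ_x)| ≤ C e^{−κ(ρ) ‖x‖_∞}`, `κ(ρ) = (1 − ρ)²/(2(16ρ + 1))`.
Proof: DLR smoothing of both observables under `μ` (a DLR state), Feller continuity of the smoothed
observables, weak limit of the one-torus star door along the subsequence
(`su2Star_limitState_cov_far`), near/far split as in `StarFront`. -/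
theorem su2Star_limitState_covariance_decay (βW : ℝ) {ρ : ℝ} (hρ0 : 0 ≤ ρ) (hρ1 : ρ < 1)
    (L₁ : ℕ) (hS : ∀ (L : ℕ) [NeZero L], L₁ ≤ L → StarWindowBound L βW ρ suFrobDist)
    (F₁ F₂ : LGConfig 4 (Matrix.specialUnitaryGroup (Fin 2) ℂ) → ℝ)
    (h₁ : Literature.MathematicalPhysics.QuantumLattice.IsLocalObservable F₁)
    (h₂ : Literature.MathematicalPhysics.QuantumLattice.IsLocalObservable F₂) (h₁m : Measurable F₁)
    (h₂m : Measurable F₂) (hb₁ : ∃ C, ∀ U, |F₁ U| ≤ C) (hb₂ : ∃ C, ∀ U, |F₂ U| ≤ C) :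
    ∃ C : ℝ, ∀ μ ∈ infiniteVolumeLimitPoints (d := 4) (fundamentalRep (Fin 2)) (βW / 2),
      ∀ x : Literature.Probability.LatticeModels.Site 4,
        |cov[F₁, fun U => F₂ (Literature.MathematicalPhysics.QuantumLattice.configShift x U); μ]| ≤
          C * Real.exp (-starRate ρ * ‖x‖) := by
  classical
  obtain ⟨S₁, hS₁⟩ := h₁
  obtain ⟨S₂, hS₂⟩ := h₂
  obtain ⟨M₁, hM₁⟩ := hb₁
  obtain ⟨M₂, hM₂⟩ := hb₂
  have hκ0 : 0 < starRate ρ := starRate_pos hρ0 hρ1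
  have hM₁0 : 0 ≤ M₁ := (abs_nonneg _).trans (hM₁ fun _ => 1)
  have hM₂0 : 0 ≤ M₂ := (abs_nonneg _).trans (hM₂ fun _ => 1)
  have hE0 : 0 ≤ wilsonSmoothLip 2 4 (βW / 2) := wilsonSmoothLip_nonneg (by norm_num) 4 (βW / 2)
  have hJ0 : (0 : ℝ) ≤ (((1 + 4 * (2 * (4 - 1)) : ℕ) : ℝ)) := Nat.cast_nonneg _
  -- the diameter of the two supports, the constant
  have hD : ∀ a₀ ∈ S₁, ∀ b₀ ∈ S₂, Literature.Probability.LatticeModels.Site.supNorm (a₀.1 - b₀.1) ≤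
      (S₁ ×ˢ S₂).sup fun ab => Literature.Probability.LatticeModels.Site.supNorm (ab.1.1 - ab.2.1) :=
    fun a₀ ha₀ b₀ hb₀ => Finset.le_sup
      (f := fun ab : Literature.MathematicalPhysics.QuantumLattice.ZdEdge 4 ×
          Literature.MathematicalPhysics.QuantumLattice.ZdEdge 4 =>
        Literature.Probability.LatticeModels.Site.supNorm (ab.1.1 - ab.2.1))
      (Finset.mk_mem_product ha₀ hb₀)
  generalize ((S₁ ×ˢ S₂).sup fun ab =>
    Literature.Probability.LatticeModels.Site.supNorm (ab.1.1 - ab.2.1)) = D at hD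
  set K' : ℝ := Real.exp (starRate ρ * ((D + 6 : ℕ) : ℝ)) with hK'def
  have hK'0 : 0 < K' := Real.exp_pos _
  set A : ℝ := 4 * (2 * Real.sqrt 2) ^ 2 *
      (((((1 + 4 * (2 * (4 - 1))) * S₁.card : ℕ) : ℝ)) * (((1 + 4 * (2 * (4 - 1)) : ℕ) : ℝ)) *
        (M₁ * wilsonSmoothLip 2 4 (βW / 2))) *
      (((((1 + 4 * (2 * (4 - 1))) * S₂.card : ℕ) : ℝ)) * (((1 + 4 * (2 * (4 - 1)) : ℕ) : ℝ)) *
        (M₂ * wilsonSmoothLip 2 4 (βW / 2))) with hAdef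
  have hA0 : 0 ≤ A := by positivity
  refine ⟨2 * M₁ * M₂ * K' + A * K', fun μ hμ x => ?_⟩
  obtain ⟨Lseq, hLmono, hμL⟩ := hμ
  haveI := hμL.1
  have hGxm : Measurable (F₂ ∘ Literature.MathematicalPhysics.QuantumLattice.configShift x) :=
    h₂m.comp (Literature.MathematicalPhysics.QuantumLattice.configShift x).measurable
  have hGxM : ∀ U, |(F₂ ∘ Literature.MathematicalPhysics.QuantumLattice.configShift x) U| ≤ M₂ :=
    fun U => hM₂ _
  have hcov : cov[F₁, fun U => F₂ (Literature.MathematicalPhysics.QuantumLattice.configShift x U); μ] =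
      (∫ U, F₁ U * (F₂ ∘ Literature.MathematicalPhysics.QuantumLattice.configShift x) U ∂μ) -
        (∫ U, F₁ U ∂μ) *
          ∫ U, (F₂ ∘ Literature.MathematicalPhysics.QuantumLattice.configShift x) U ∂μ := by
    have l₁ : MemLp F₁ 2 μ := memLp_of_bounded (a := -M₁) (b := M₁)
      (ae_of_all _ fun U => abs_le.1 (hM₁ U)) h₁m.aestronglyMeasurable 2
    have l₂ : MemLp (F₂ ∘ Literature.MathematicalPhysics.QuantumLattice.configShift x) 2 μ :=
      memLp_of_bounded (a := -M₂) (b := M₂) (ae_of_all _ fun U => abs_le.1 (hGxM U))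
        hGxm.aestronglyMeasurable 2
    exact covariance_eq_sub l₁ l₂
  rw [Literature.Probability.LatticeModels.Site.norm_eq_supNorm x, hcov]
  have hexp0 : 0 < Real.exp (-starRate ρ * (Literature.Probability.LatticeModels.Site.supNorm x : ℕ)) :=
    Real.exp_pos _
  by_cases hnear : Literature.Probability.LatticeModels.Site.supNorm x < D + 6
  · -- NEAR: the trivial bound `|cov| ≤ 2 M₁ M₂` and `K' e^{-κ ‖x‖} ≥ 1`
    have htriv : |(∫ U, F₁ U * (F₂ ∘ Literature.MathematicalPhysics.QuantumLattice.configShift x) U ∂μ) -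
        (∫ U, F₁ U ∂μ) *
          ∫ U, (F₂ ∘ Literature.MathematicalPhysics.QuantumLattice.configShift x) U ∂μ| ≤
        2 * M₁ * M₂ := by
      refine (abs_sub _ _).trans ?_
      have h1 := abs_integral_le_of_abs_le (μ := μ) (abs_mul_le_of_abs_le hM₁ hGxM)
      have h2 : |(∫ U, F₁ U ∂μ) *
          ∫ U, (F₂ ∘ Literature.MathematicalPhysics.QuantumLattice.configShift x) U ∂μ| ≤ M₁ * M₂ := by
        rw [abs_mul]
        exact mul_le_mul (abs_integral_le_of_abs_le hM₁) (abs_integral_le_of_abs_le hGxM)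
          (abs_nonneg _) hM₁0
      linarith
    have hone : 1 ≤ K' *
        Real.exp (-starRate ρ * (Literature.Probability.LatticeModels.Site.supNorm x : ℕ)) := by
      rw [hK'def, ← Real.exp_add]
      refine Real.one_le_exp ?_
      have : ((Literature.Probability.LatticeModels.Site.supNorm x : ℕ) : ℝ) ≤ ((D + 6 : ℕ) : ℝ) := by
        exact_mod_cast hnear.le
      nlinarith
    refine htriv.trans ?_
    have h2MM : 0 ≤ 2 * M₁ * M₂ := by positivity
    calc 2 * M₁ * M₂ ≤ 2 * M₁ * M₂ * (K' *
          Real.exp (-starRate ρ * (Literature.Probability.LatticeModels.Site.supNorm x : ℕ))) :=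
          le_mul_of_one_le_right h2MM hone
      _ = 2 * M₁ * M₂ * K' *
          Real.exp (-starRate ρ * (Literature.Probability.LatticeModels.Site.supNorm x : ℕ)) := by
          ring
      _ ≤ (2 * M₁ * M₂ * K' + A * K') *
          Real.exp (-starRate ρ * (Literature.Probability.LatticeModels.Site.supNorm x : ℕ)) := by
          rw [add_mul]
          exact le_add_of_nonneg_right (mul_nonneg (mul_nonneg hA0 hK'0.le) hexp0.le)
  -- FAR: `D + 6 ≤ ‖x‖_∞`
  rw [not_lt] at hnear
  have hle := su2Star_limitState_cov_far βW hρ0 hρ1 L₁ hS hLmono hμL h₁m h₂m hS₁ hS₂ hM₁ hM₂ x hD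
    hnear
  refine hle.trans ?_
  have hexp : Real.exp (-(starRate ρ *
      ((Literature.Probability.LatticeModels.Site.supNorm x - (D + 2 + 4) : ℕ) : ℝ))) ≤
      K' * Real.exp (-starRate ρ * (Literature.Probability.LatticeModels.Site.supNorm x : ℕ)) := by
    rw [hK'def, ← Real.exp_add]
    refine Real.exp_le_exp.2 ?_
    have : ((Literature.Probability.LatticeModels.Site.supNorm x - (D + 2 + 4) : ℕ) : ℝ) =
        (Literature.Probability.LatticeModels.Site.supNorm x : ℝ) - ((D + 6 : ℕ) : ℝ) := by
      rw [show D + 2 + 4 = D + 6 by ring, Nat.cast_sub hnear]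
    rw [this]
    nlinarith
  have hB0 : 0 ≤ (((((1 + 4 * (2 * (4 - 1))) * S₁.card : ℕ) : ℝ)) * (((1 + 4 * (2 * (4 - 1)) : ℕ) : ℝ)) *
      (M₁ * wilsonSmoothLip 2 4 (βW / 2))) := by positivity
  have hC0 : 0 ≤ (((((1 + 4 * (2 * (4 - 1))) * S₂.card : ℕ) : ℝ)) * (((1 + 4 * (2 * (4 - 1)) : ℕ) : ℝ)) *
      (M₂ * wilsonSmoothLip 2 4 (βW / 2))) := by positivity
  have h4 : (0 : ℝ) ≤ 4 * (2 * Real.sqrt 2) ^ 2 := by positivity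
  calc 4 * (2 * Real.sqrt 2) ^ 2 *
        Real.exp (-(starRate ρ *
          ((Literature.Probability.LatticeModels.Site.supNorm x - (D + 2 + 4) : ℕ) : ℝ))) *
        (((((1 + 4 * (2 * (4 - 1))) * S₁.card : ℕ) : ℝ)) * (((1 + 4 * (2 * (4 - 1)) : ℕ) : ℝ)) *
          (M₁ * wilsonSmoothLip 2 4 (βW / 2))) *
        (((((1 + 4 * (2 * (4 - 1))) * S₂.card : ℕ) : ℝ)) * (((1 + 4 * (2 * (4 - 1)) : ℕ) : ℝ)) *
          (M₂ * wilsonSmoothLip 2 4 (βW / 2)))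
      ≤ 4 * (2 * Real.sqrt 2) ^ 2 * (K' *
          Real.exp (-starRate ρ * (Literature.Probability.LatticeModels.Site.supNorm x : ℕ))) *
        (((((1 + 4 * (2 * (4 - 1))) * S₁.card : ℕ) : ℝ)) * (((1 + 4 * (2 * (4 - 1)) : ℕ) : ℝ)) *
          (M₁ * wilsonSmoothLip 2 4 (βW / 2))) *
        (((((1 + 4 * (2 * (4 - 1))) * S₂.card : ℕ) : ℝ)) * (((1 + 4 * (2 * (4 - 1)) : ℕ) : ℝ)) *
          (M₂ * wilsonSmoothLip 2 4 (βW / 2))) :=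
        mul_le_mul_of_nonneg_right (mul_le_mul_of_nonneg_right
          (mul_le_mul_of_nonneg_left hexp h4) hB0) hC0
    _ = A * K' * Real.exp (-starRate ρ * (Literature.Probability.LatticeModels.Site.supNorm x : ℕ)) := by
        rw [hAdef]; ring
    _ ≤ (2 * M₁ * M₂ * K' + A * K') *
          Real.exp (-starRate ρ * (Literature.Probability.LatticeModels.Site.supNorm x : ℕ)) := by
        rw [add_mul]
        exact le_add_of_nonneg_left (by positivity)

/-- **Every infinite-volume limit state is massive, from the star window bound** (`SU(2)`, `d = 4`):
if every torus of side `L ≥ L₁` carries `StarWindowBound L β_W ρ suFrobDist` with `ρ < 1`, then every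
`μ ∈ infiniteVolumeLimitPoints (d := 4) (fundamentalRep (Fin 2)) (β_W/2)` is a massive state in the
sense of `Literature.Barriers.QuantumFields.IsMassiveState` (exponential clustering, at the one rate
`κ(ρ)`, of all truncated correlations of bounded measurable local observables; the gauge-invariance
clauses of that predicate are not needed). -/
theorem su2Star_isMassiveState (βW : ℝ) {ρ : ℝ} (hρ0 : 0 ≤ ρ) (hρ1 : ρ < 1) (L₁ : ℕ)
    (hS : ∀ (L : ℕ) [NeZero L], L₁ ≤ L → StarWindowBound L βW ρ suFrobDist) :
    ∀ μ ∈ infiniteVolumeLimitPoints (d := 4) (fundamentalRep (Fin 2)) (βW / 2), IsMassiveState μ := by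
  intro μ hμ
  refine ⟨starRate ρ, fun F₁ F₂ h₁ h₂ h₁m h₂m hb₁ hb₂ _ _ => ?_⟩
  obtain ⟨C, hC⟩ := su2Star_limitState_covariance_decay βW hρ0 hρ1 L₁ hS F₁ F₂ h₁ h₂ h₁m h₂m hb₁ hb₂
  exact ⟨starRate_pos hρ0 hρ1, C, fun x => hC μ hμ x⟩

/-- **Lemma-G form** (the hypothesis is literally the `hG` of ds-1's
`DSWindow.su2_strongCouplingFront_of_lemmaG`, which ds-4's `starWindowBound_lemmaG` discharges for
`β_W ≤ 1/2`): if the gauge-fixed star window bound holds on every torus of side `≥ 3` at every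
`0 ≤ β_W ≤ β₀` with received sum `R_G(β_W)`, where `β₀ ≤ 7/10` and `R_G(β₀) < 1`, then at every
`0 ≤ β_W ≤ β₀` every infinite-volume limit state of `SU(2)` lattice Yang–Mills (`d = 4`, Wilson, tree
coupling `β_W/2`) is massive, with rate `κ(R_G(β₀))`. -/
theorem su2_isMassiveState_of_lemmaG (β₀ : ℝ) (h0 : 0 ≤ β₀) (h7 : β₀ ≤ 7 / 10)
    (hρ : gaugeR β₀ < 1)
    (hG : ∀ (L : ℕ) [NeZero L], 3 ≤ L → ∀ βW : ℝ, 0 ≤ βW → βW ≤ β₀ →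
      StarWindowBound L βW (gaugeR βW) suFrobDist)
    {βW : ℝ} (hβ0 : 0 ≤ βW) (hβ1 : βW ≤ β₀) :
    ∀ μ ∈ infiniteVolumeLimitPoints (d := 4) (fundamentalRep (Fin 2)) (βW / 2), IsMassiveState μ := by
  have hρ0 : 0 ≤ gaugeR β₀ := by
    have hΔ := StarWindowGauge.Delta_pos (c := β₀ / 4) (by linarith) (by linarith)
    unfold gaugeR
    positivity
  refine su2Star_isMassiveState βW hρ0 hρ 3 fun L _ hL => ?_
  obtain ⟨K, hK, hKloc, hcontract, hsum⟩ := hG L hL βW hβ0 hβ1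
  exact ⟨K, hK, hKloc, hcontract, fun s y hy => (hsum s y hy).trans (gaugeR_mono hβ0 hβ1 h7)⟩

/-- **The `9/25` row**: given Lemma G on all tori of side `≥ 3` up to `β_W = 9/25`
(`R_G(9/25) = 2943/2957 < 1`), every infinite-volume limit state of `SU(2)` lattice Yang–Mills
(`d = 4`, Wilson) at every `0 ≤ β_W ≤ 9/25` is massive. -/
theorem su2_isMassiveState_le_9_25_of_lemmaG
    (hG : ∀ (L : ℕ) [NeZero L], 3 ≤ L → ∀ βW : ℝ, 0 ≤ βW → βW ≤ 9 / 25 →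
      StarWindowBound L βW (gaugeR βW) suFrobDist)
    {βW : ℝ} (hβ0 : 0 ≤ βW) (hβ1 : βW ≤ 9 / 25) :
    ∀ μ ∈ infiniteVolumeLimitPoints (d := 4) (fundamentalRep (Fin 2)) (βW / 2), IsMassiveState μ :=
  su2_isMassiveState_of_lemmaG (9 / 25) (by norm_num) (by norm_num)
    (StarWindowGauge.gaugeR_lt_one_of_le (by norm_num) le_rfl) hG hβ0 hβ1

end Summit.Ventures.YMGap.StarLimit

end
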